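import Mathlib.Analysis.Complex.ExponentialBounds
import Summits.AtomisticToContinuum.HydrodynamicLimit.Theorems.CollisionIsometryCLTMacroClosureRuelleMaster
import Summits.AtomisticToContinuum.HydrodynamicLimit.Theorems.CollisionIsometryCLTMacroClosureFvBccLower
import HarnessLib

/-!
# A-priori exponential lower bound for the inner-cube box free volume (stub `tl_apriori`)

Helper for support item stmt-AtomisticToContinuum-14870 (`MacroClosure`, line `IdeatorTwoGen1Sketch`,
wave 4, thermodynamic-limit step). Ruelle's inner-cube box free volume of `m` labelled points at
density `η` is the Lebesgue measure of

`B(m, η) = {w : Fin m → ℝ³ | |w i l| ≤ (1 - t)/2, ‖w i - w j‖ ≥ t (i ≠ j)}`, `t = (η/m)^{1/3}`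

(points of the closed unit cube kept `t/2` away from its boundary, pairwise at distance `≥ t`).
We prove `vol B(m, η) ≥ e^{-Cm}` for all `m ≥ m₀` and all densities `0 < η ≤ 23/20`:

* scaling by `s = 1 - t` (`FvCubeToTorus.smul_set_subset`, `FvCubeToTorus.volume_smul_set`):
  `vol B ≥ s^{3m} · vol U`, `U` the unit-cube constraint set at exclusion `t/s`;
* the torus free volume is at most the unit-cube Euclidean free volume
  (`FvCubeToTorus.volume_posDomain_le`), and at exclusion `t/s`, i.e. density `η/s³ ≤ 6/5`
  (for `t ≤ 1/100`), it dominates `hsFreeVolume (6/5) m`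
  (`RuelleMaster.hsFreeVolume_le_volume_posDomain`, monotonicity in the density);
* the body-centred-cubic bound `hsFreeVolume (6/5) m ≥ e^{-C₀ m}` (`fv_bcc_lower`) and
  `s^{3m} ≥ (e^{-1})^{3m}` give `C = C₀ + 3`.

Reference: D. Ruelle, *Statistical Mechanics: Rigorous Results* (1969), §3.4.
-/

namespace Summit.AtomisticToContinuum.HydrodynamicLimit.Theorems.MacroClosureLine

open MeasureTheory Filter Set Topology
open scoped ENNReal Pointwise
open Literature.MathematicalPhysics.KineticTheory Literature.Analysis.FluidPDE Literature.Analysis.FunctionSpaces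

namespace Barycentric

namespace TlApriori

/-- A point of the closed cube `[-1/2, 1/2]³` has Euclidean norm at most `1` (`≤ √3/2`).
[folklore] -/
theorem norm_le_one_of_abs_le {v : V3} (h : ∀ l, |v l| ≤ 1 / 2) : ‖v‖ ≤ 1 := by
  have hc : ∀ l, ‖v l‖ ^ 2 ≤ 1 / 4 := fun l => by
    rw [Real.norm_eq_abs]
    have h1 := h l
    nlinarith [abs_nonneg (v l)]
  rw [EuclideanSpace.norm_eq]
  refine (Real.sqrt_le_sqrt ?_).trans_eq Real.sqrt_one
  rw [Fin.sum_univ_three]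
  linarith [hc 0, hc 1, hc 2]

/-- The Euclidean constraint set of the cube of side `s ≤ 1` lies in the closed unit ball of
`(ℝ³)^n` (sup norm over the particles), hence has finite Lebesgue measure. [folklore] -/
theorem volume_constraint_ne_top (n : ℕ) {s : ℝ} (hs : s ≤ 1) (r : ℝ) :
    volume {v : Fin n → V3 | (∀ i l, |v i l| ≤ s / 2) ∧ ∀ i i', i ≠ i' → r ≤ ‖v i - v i'‖} ≠ ∞ := by
  refine (lt_of_le_of_lt (measure_mono fun v hv => ?_)
    (measure_closedBall_lt_top (x := (0 : Fin n → V3)) (r := 1))).ne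
  rw [mem_closedBall_zero_iff, pi_norm_le_iff_of_nonneg zero_le_one]
  exact fun i => norm_le_one_of_abs_le fun l => (hv.1 i l).trans (by linarith)

/-- **Scaling and torus comparison.** For `0 < s ≤ 1`:
`s^{3n} · vol (posDomain (t/s) n) ≤ vol {v | |v i l| ≤ s/2, ‖v i - v i'‖ ≥ t}` (the torus free
volume at exclusion `t/s` is at most the unit-cube Euclidean free volume at exclusion `t/s`, whose
homothetic image of ratio `s` lies in the side-`s` constraint set at exclusion `t`). [folklore] -/
theorem pow_mul_toReal_le (n : ℕ) {s : ℝ} (hs0 : 0 < s) (hs1 : s ≤ 1) (t : ℝ) :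
    s ^ (3 * n) * (volume (posDomain (t / s) n)).toReal ≤
      (volume {v : Fin n → V3 | (∀ i l, |v i l| ≤ s / 2) ∧
        ∀ i i', i ≠ i' → t ≤ ‖v i - v i'‖}).toReal := by
  have key : ENNReal.ofReal (s ^ (3 * n)) * volume (posDomain (t / s) n) ≤
      volume {v : Fin n → V3 | (∀ i l, |v i l| ≤ s / 2) ∧ ∀ i i', i ≠ i' → t ≤ ‖v i - v i'‖} :=
    calc ENNReal.ofReal (s ^ (3 * n)) * volume (posDomain (t / s) n)
        ≤ ENNReal.ofReal (s ^ (3 * n)) * volume {w : Fin n → V3 | (∀ i l, |w i l| ≤ 1 / 2) ∧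
            ∀ i i', i ≠ i' → t / s ≤ ‖w i - w i'‖} :=
          mul_le_mul_right (FvCubeToTorus.volume_posDomain_le n (t / s)) _
      _ = volume (s • {w : Fin n → V3 | (∀ i l, |w i l| ≤ 1 / 2) ∧
            ∀ i i', i ≠ i' → t / s ≤ ‖w i - w i'‖}) := (FvCubeToTorus.volume_smul_set n hs0.le _).symm
      _ ≤ _ := measure_mono (FvCubeToTorus.smul_set_subset n t hs0)
  have h := ENNReal.toReal_mono (volume_constraint_ne_top n hs1 t) key
  rwa [ENNReal.toReal_mul, ENNReal.toReal_ofReal (pow_nonneg hs0.le _)] at h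

/-- **Parameter bookkeeping.** For `m ≥ 2 · 10⁶` and `0 < η ≤ 23/20` the exclusion distance
`t = (η/m)^{1/3}` satisfies `0 < t ≤ 1/100`, so with `s = 1 - t`: `m (t/s)³ = η/s³ ≤ 6/5` and
`e^{-1} ≤ s`. [folklore] -/
theorem params {m : ℕ} (hm : 2000000 ≤ m) {η : ℝ} (hη : 0 < η) (hη' : η ≤ 23 / 20) :
    0 < (η / m) ^ (1 / 3 : ℝ) ∧ (η / m) ^ (1 / 3 : ℝ) ≤ 1 / 100 ∧
      (m : ℝ) * ((η / m) ^ (1 / 3 : ℝ) / (1 - (η / m) ^ (1 / 3 : ℝ))) ^ 3 ≤ 6 / 5 ∧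
      Real.exp (-1) ≤ 1 - (η / m) ^ (1 / 3 : ℝ) := by
  have hmR : (2000000 : ℝ) ≤ m := by exact_mod_cast hm
  have hm0 : (0 : ℝ) < m := by linarith
  set t : ℝ := (η / m) ^ (1 / 3 : ℝ) with ht
  have ht0 : 0 < t := Real.rpow_pos_of_pos (div_pos hη hm0) _
  have ht3 : t ^ 3 = η / m := FvMixingParams.rpow_third_pow_three (η / m) (div_pos hη hm0).le
  have ht1 : t ≤ 1 / 100 := by
    refine le_of_pow_le_pow_left₀ (by norm_num : (3 : ℕ) ≠ 0) (by norm_num) ?_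
    rw [ht3, div_le_iff₀ hm0]
    norm_num
    linarith
  have hs0 : 0 < 1 - t := by linarith
  refine ⟨ht0, ht1, ?_, ?_⟩
  · have hs3 : (99 / 100 : ℝ) ^ 3 ≤ (1 - t) ^ 3 := pow_le_pow_left₀ (by norm_num) (by linarith) 3
    rw [div_pow, ht3, show (m : ℝ) * (η / m / (1 - t) ^ 3) = η / (1 - t) ^ 3 by field_simp,
      div_le_iff₀ (pow_pos hs0 3)]
    norm_num at hs3
    linarith
  · linarith [Real.exp_neg_one_lt_d9]

end TlApriori

open TlApriori in
/-- **A-priori bound for the inner-cube box free volume (wave 4, stub `tl_apriori`).** There are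
`C` and `m₀` such that for all `m ≥ m₀` and all densities `0 < η ≤ 23/20`, with `t = (η/m)^{1/3}`,
the Lebesgue measure of the set of `m` labelled points of the cube `[-(1-t)/2, (1-t)/2]³` that are
pairwise at Euclidean distance `≥ t` is at least `e^{-Cm}`: scale the unit-cube constraint set by
`1 - t`, compare with the torus free volume at density `η/(1-t)³ ≤ 6/5`, and use the
body-centred-cubic bound `fv_bcc_lower`. [cite: Ruelle1969, §3.4] -/
theorem tl_apriori : ∃ C : ℝ, ∃ m₀ : ℕ, ∀ m : ℕ, m₀ ≤ m → ∀ η : ℝ, 0 < η → η ≤ 23 / 20 → Real.exp (-(C * m)) ≤ (volume {w : Fin m → V3 | (∀ i l, |w i l| ≤ (1 - (η / m) ^ (1 / 3 : ℝ)) / 2) ∧ ∀ i j, i ≠ j → (η / m) ^ (1 / 3 : ℝ) ≤ ‖w i - w j‖}).toReal := by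
  obtain ⟨C₀, N₀, hC₀⟩ := fv_bcc_lower
  refine ⟨C₀ + 3, max N₀ 2000000, fun m hm η hη hη' => ?_⟩
  have hmN₀ : N₀ ≤ m := le_of_max_le_left hm
  obtain ⟨ht0, ht1, hdens, hexp⟩ := params (le_of_max_le_right hm) hη hη'
  set t : ℝ := (η / m) ^ (1 / 3 : ℝ) with ht
  set s : ℝ := 1 - t with hs
  have hs0 : 0 < s := by rw [hs]; linarith
  have hs1 : s ≤ 1 := by rw [hs]; linarith
  have hfv : hsFreeVolume (6 / 5) m ≤ (volume (posDomain (t / s) m)).toReal :=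
    RuelleMaster.hsFreeVolume_le_volume_posDomain m (div_nonneg ht0.le hs0.le) hdens
  have hpow : Real.exp (-(3 * (m : ℝ))) ≤ s ^ (3 * m) := by
    have h := pow_le_pow_left₀ (Real.exp_pos (-1)).le hexp (3 * m)
    rwa [← Real.exp_nat_mul, show ((3 * m : ℕ) : ℝ) * (-1) = -(3 * (m : ℝ)) by push_cast; ring]
      at h
  calc Real.exp (-((C₀ + 3) * m)) = Real.exp (-(3 * (m : ℝ))) * Real.exp (-(C₀ * m)) := by
        rw [← Real.exp_add]; ring_nf
    _ ≤ s ^ (3 * m) * hsFreeVolume (6 / 5) m :=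
        mul_le_mul hpow (hC₀ m hmN₀) (Real.exp_pos _).le (pow_nonneg hs0.le _)
    _ ≤ s ^ (3 * m) * (volume (posDomain (t / s) m)).toReal :=
        mul_le_mul_of_nonneg_left hfv (pow_nonneg hs0.le _)
    _ ≤ _ := pow_mul_toReal_le m hs0 hs1 t

end Barycentric

end Summit.AtomisticToContinuum.HydrodynamicLimit.Theorems.MacroClosureLine
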